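import Summits.CriticalPhenomena.Ising3D.Control2DIsingSequences
import Mathlib.Tactic
import HarnessLib

/-!
# The 2D Ising witness, V: the Taylor coefficients of `f₁`, `f₂` satisfy the same recurrence
(cell `pub-ising3x`, seat controls-1 gen 37; NON-VACUITY of the 2D control's `A2D′` classes at
`Δ_σ = 1/8` by the Ising datum, step 5 — CONTROL-ONLY)

HONEST FRAMING: lottery ticket; floor = tightest certified 3D Ising CFT bounds; no exact-solution
claim without a proof. CONTROL-ONLY (`d = 2`); nothing numerical is asserted here.

The `c = 1/2` Virasoro blocks of `⟨σσσσ⟩` are elementary: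
`f₁(x) = (1-x)^{-1/8} w₁(x)`, `f₂(x) = (1-x)^{-1/8} w₂(x)`, `w₁ = (√(1+√x) + √(1-√x))/2 = Σ_n C(1/2,2n) x^n`,
`w₂ = (√(1+√x) - √(1-√x))/2 = √x Σ_n C(1/2,2n+1) x^n` (Belavin–Polyakov–Zamolodchikov 1984: the two
solutions `(1-x)^{-1/8} ₂F₁(1/4,-1/4;1/2;x)`, `(1-x)^{-1/8} x^{1/2} ₂F₁(3/4,1/4;3/2;x)/2` of the level-2
null-vector equation; `₂F₁(a,-a;1/2;sin²θ) = cos 2aθ`). Hence the coefficient of `x^{σ+N}` in `f_i` is the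
CONVOLUTION `e_N = Σ_{k+n=N} β_k ω_n`, `β_k = (1/8)_k/k!` (`isingBeta`), `ω = isingOmega₁/₂`
(`ω₁(n) = (-1/2)_{2n}/(2n)!`, `ω₂(n) = -(-1/2)_{2n+1}/(2n+1)!`; `σ = 0`, resp. `1/2`).
This file proves, by finite algebra only, that such a convolution satisfies EXACTLY the second-order
recurrence of `Control2DIsingRecursion` (`conv_res`; this is the coefficient form of the factorisation
`𝓑 ∘ (1-x)^{-1/8} = (1-x)^{-1/8} x (1-x) ∘ Hyp`, `Hyp` the hypergeometric operator of `₂F₁(1/4,-1/4;1/2;·)`,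
reduced to a per-term identity plus one telescoping over the anti-diagonal), and that the recurrence
determines a sequence from its first term (`eq_of_res`). CONSEQUENCE (`famCoeff_isingA`,
`famCoeff_isingB`): the `x`-coefficients of `Σ_j A_j k_{4j}` are those of `f₁`, and of `Σ_j B_j k_{4j+1}`
those of `f₂` — WITHOUT a closed form for `A_j, B_j`. The analytic summation is `Control2DIsingChiral`.

References: A. A. Belavin, A. M. Polyakov, A. B. Zamolodchikov, Nucl. Phys. B 241 (1984) 333, §5, App. E
[cite: BelavinPolyakovZamolodchikov1984, App. E]. Tree: `famCoeff_res/_zero/_one`, `isingIdFamily`,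
`isingEpsFamily`, `poch`.
-/

namespace Summit.CriticalPhenomena.Ising3D.Control2D

open Finset
open Literature.MathematicalPhysics.QuantumFieldTheory.ConformalBootstrap3D

/-! ### The Taylor data -/

/-- `β_k = (1/8)_k / k!`, the coefficients of `(1-x)^{-1/8} = Σ_k β_k x^k`. [folklore] -/
noncomputable def isingBeta (k : ℕ) : ℝ := poch (1 / 8) k / (k.factorial : ℝ)

/-- `ω₁(n) = (-1/2)_{2n}/(2n)! = C(1/2, 2n)`, the coefficients of `w₁ = (√(1+√x)+√(1-√x))/2 = Σ_n ω₁(n) x^n`.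
[folklore] -/
noncomputable def isingOmega₁ (n : ℕ) : ℝ := poch (-1 / 2) (2 * n) / ((2 * n).factorial : ℝ)

/-- `ω₂(n) = -(-1/2)_{2n+1}/(2n+1)! = C(1/2, 2n+1)`, the coefficients of
`w₂ = (√(1+√x)-√(1-√x))/2 = √x Σ_n ω₂(n) x^n`. [folklore] -/
noncomputable def isingOmega₂ (n : ℕ) : ℝ := -(poch (-1 / 2) (2 * n + 1) / ((2 * n + 1).factorial : ℝ))

/-- The convolution `e_N = Σ_{k+n=N} β_k ω_n` (Cauchy product coefficients). [folklore] -/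
noncomputable def conv (β ω : ℕ → ℝ) (N : ℕ) : ℝ := ∑ p ∈ antidiagonal N, β p.1 * ω p.2

/-- `β_0 = 1`. [folklore] -/
@[simp] theorem isingBeta_zero : isingBeta 0 = 1 := by simp [isingBeta]

/-- `β_{k+1} = β_k (k + 1/8)/(k + 1)` (i.e. `(1-x) B' = B/8`, coefficientwise). [folklore] -/
theorem isingBeta_succ (k : ℕ) : isingBeta (k + 1) = isingBeta k * (((k : ℝ) + 1 / 8) / ((k : ℝ) + 1)) := by
  unfold isingBeta
  rw [poch_succ, Nat.factorial_succ]
  push_cast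
  have : ((k : ℝ) + 1) ≠ 0 := by positivity
  have : (k.factorial : ℝ) ≠ 0 := by positivity
  field_simp
  ring

/-- `ω₁(0) = 1`, `ω₂(0) = 1/2`. [folklore] -/
theorem isingOmega_zero : isingOmega₁ 0 = 1 ∧ isingOmega₂ 0 = 1 / 2 := by
  constructor
  · simp [isingOmega₁]
  · norm_num [isingOmega₂]

/-- **`w₁` solves the hypergeometric equation of `₂F₁(-1/4,1/4;1/2;·)`**, coefficientwise (`σ = 0`):
`(n+1)(n+1/2) ω₁(n+1) = (n-1/4)(n+1/4) ω₁(n)`. [cite: BelavinPolyakovZamolodchikov1984, App. E] -/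
theorem isingOmega₁_rec (n : ℕ) :
    ((n : ℝ) + 1 + 0) * ((n : ℝ) + 0 + 1 / 2) * isingOmega₁ (n + 1) =
      ((n : ℝ) + 0 - 1 / 4) * ((n : ℝ) + 0 + 1 / 4) * isingOmega₁ n := by
  unfold isingOmega₁
  rw [show 2 * (n + 1) = 2 * n + 1 + 1 by ring, poch_succ, poch_succ, Nat.factorial_succ, Nat.factorial_succ]
  push_cast
  have : ((2 * n).factorial : ℝ) ≠ 0 := by positivity
  have : (2 * (n : ℝ) + 1) ≠ 0 := by positivity
  have : (2 * (n : ℝ) + 1 + 1) ≠ 0 := by positivity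
  field_simp
  ring

/-- **`√x Σ ω₂(n) x^n` is the second solution** (`σ = 1/2`): `(n+3/2)(n+1) ω₂(n+1) = (n+1/4)(n+3/4) ω₂(n)`.
[cite: BelavinPolyakovZamolodchikov1984, App. E] -/
theorem isingOmega₂_rec (n : ℕ) :
    ((n : ℝ) + 1 + 1 / 2) * ((n : ℝ) + 1 / 2 + 1 / 2) * isingOmega₂ (n + 1) =
      ((n : ℝ) + 1 / 2 - 1 / 4) * ((n : ℝ) + 1 / 2 + 1 / 4) * isingOmega₂ n := by
  unfold isingOmega₂
  rw [show 2 * (n + 1) + 1 = 2 * n + 1 + 1 + 1 by ring, poch_succ, poch_succ, Nat.factorial_succ,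
    Nat.factorial_succ]
  push_cast
  have : ((2 * n + 1).factorial : ℝ) ≠ 0 := by positivity
  have : (2 * (n : ℝ) + 1 + 1) ≠ 0 := by positivity
  have : (2 * (n : ℝ) + 1 + 1 + 1) ≠ 0 := by positivity
  field_simp
  ring

/-! ### The convolution satisfies the recurrence -/

/-- The per-term identity behind `𝓑 ∘ B = B x(1-x) ∘ Hyp` (`B = (1-x)^{-1/8}`): for every `k` and real `p`,
`(p+k+2)(p+k+3/2) β_{k+2} - (p+k+1)(2p+2k+7/4) β_{k+1} + (p+k+3/8)(p+k-1/8) β_k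
 = p(p-1/2)(β_{k+2} - β_{k+1}) - (p-1/4)(p+1/4)(β_{k+1} - β_k)`. [folklore] -/
theorem isingBeta_per_term (k : ℕ) (p : ℝ) :
    (p + k + 2) * (p + k + 3 / 2) * isingBeta (k + 2) - (p + k + 1) * (2 * p + 2 * k + 7 / 4) * isingBeta (k + 1)
      + (p + k + 3 / 8) * (p + k - 1 / 8) * isingBeta k =
      p * (p - 1 / 2) * (isingBeta (k + 2) - isingBeta (k + 1))
        - (p - 1 / 4) * (p + 1 / 4) * (isingBeta (k + 1) - isingBeta k) := by
  rw [show k + 2 = k + 1 + 1 from rfl, isingBeta_succ (k + 1), isingBeta_succ k]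
  have h1 : ((k : ℝ) + 1) ≠ 0 := by positivity
  have h2 : (((k + 1 : ℕ) : ℝ) + 1) ≠ 0 := by positivity
  push_cast
  field_simp
  ring

/-- **A convolution `β ∗ ω` with `ω` hypergeometric satisfies the `𝓑`-recurrence** (generic coefficient).
Hypotheses: the indicial relation `σ(σ - 1/2) = 0` and the first-order recurrence of `ω` at offset `σ`.
Proof: per-term identity + one telescoping along the anti-diagonal. [cite: BelavinPolyakovZamolodchikov1984, App. E] -/
theorem conv_res {σ : ℝ} {ω : ℕ → ℝ} (hind : σ * (σ - 1 / 2) = 0)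
    (hω : ∀ n : ℕ, ((n : ℝ) + 1 + σ) * ((n : ℝ) + σ + 1 / 2) * ω (n + 1) =
      ((n : ℝ) + σ - 1 / 4) * ((n : ℝ) + σ + 1 / 4) * ω n) (N : ℕ) :
    (σ + N + 2) * (σ + N + 3 / 2) * conv isingBeta ω (N + 2)
      - (σ + N + 1) * (2 * σ + 2 * N + 7 / 4) * conv isingBeta ω (N + 1)
      + (σ + N + 3 / 8) * (σ + N - 1 / 8) * conv isingBeta ω N = 0 := by
  -- peel the three convolutions down to `antidiagonal N`
  have e2 : conv isingBeta ω (N + 2) = isingBeta 0 * ω (N + 2) + isingBeta 1 * ω (N + 1) +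
      ∑ q ∈ antidiagonal N, isingBeta (q.1 + 2) * ω q.2 := by
    unfold conv
    rw [Nat.sum_antidiagonal_succ, Nat.sum_antidiagonal_succ]
    simp only [zero_add]
    ring
  have e1 : conv isingBeta ω (N + 1) = isingBeta 0 * ω (N + 1) +
      ∑ q ∈ antidiagonal N, isingBeta (q.1 + 1) * ω q.2 := by
    unfold conv
    rw [Nat.sum_antidiagonal_succ]
  have e0 : conv isingBeta ω N = ∑ q ∈ antidiagonal N, isingBeta q.1 * ω q.2 := rfl
  -- the telescoping sum over `antidiagonal (N+1)`, peeled in the two ways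
  set P : ℝ → ℝ := fun p => p * (p - 1 / 2) with hP
  set Q : ℝ → ℝ := fun p => (p - 1 / 4) * (p + 1 / 4) with hQ
  have T1 : ∑ q ∈ antidiagonal (N + 1), P (σ + q.2) * ω q.2 * (isingBeta (q.1 + 1) - isingBeta q.1) =
      P (σ + (N + 1 : ℕ)) * ω (N + 1) * (isingBeta 1 - isingBeta 0) +
        ∑ q ∈ antidiagonal N, P (σ + q.2) * ω q.2 * (isingBeta (q.1 + 2) - isingBeta (q.1 + 1)) := by
    rw [Nat.sum_antidiagonal_succ]
  have T2 : ∑ q ∈ antidiagonal (N + 1), P (σ + q.2) * ω q.2 * (isingBeta (q.1 + 1) - isingBeta q.1) =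
      P (σ + (0 : ℕ)) * ω 0 * (isingBeta (N + 1 + 1) - isingBeta (N + 1)) +
        ∑ q ∈ antidiagonal N, P (σ + (q.2 + 1 : ℕ)) * ω (q.2 + 1) * (isingBeta (q.1 + 1) - isingBeta q.1) := by
    rw [Nat.sum_antidiagonal_succ']
  have hP0 : P (σ + (0 : ℕ)) = 0 := by
    simp only [hP, Nat.cast_zero, add_zero]
    exact hind
  -- `Q(σ+L) ω_L = P(σ+L+1) ω_{L+1}` (the recurrence of `ω`)
  have hQP : ∀ L : ℕ, Q (σ + L) * ω L = P (σ + (L + 1 : ℕ)) * ω (L + 1) := by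
    intro L
    simp only [hP, hQ]
    have := hω L
    push_cast
    linear_combination -this
  -- main computation on `antidiagonal N`
  have main : (σ + N + 2) * (σ + N + 3 / 2) * ∑ q ∈ antidiagonal N, isingBeta (q.1 + 2) * ω q.2
      - (σ + N + 1) * (2 * σ + 2 * N + 7 / 4) * ∑ q ∈ antidiagonal N, isingBeta (q.1 + 1) * ω q.2
      + (σ + N + 3 / 8) * (σ + N - 1 / 8) * ∑ q ∈ antidiagonal N, isingBeta q.1 * ω q.2 =
      ∑ q ∈ antidiagonal N, P (σ + q.2) * ω q.2 * (isingBeta (q.1 + 2) - isingBeta (q.1 + 1))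
        - ∑ q ∈ antidiagonal N, P (σ + (q.2 + 1 : ℕ)) * ω (q.2 + 1) * (isingBeta (q.1 + 1) - isingBeta q.1) := by
    rw [mul_sum, mul_sum, mul_sum, ← sum_sub_distrib, ← sum_add_distrib, ← sum_sub_distrib]
    refine sum_congr rfl fun q hq => ?_
    have hN : (N : ℝ) = q.1 + q.2 := by
      rw [HasAntidiagonal.mem_antidiagonal] at hq
      exact_mod_cast hq.symm
    rw [← hQP q.2]
    have := isingBeta_per_term q.1 (σ + q.2)
    simp only [hP, hQ]
    rw [hN]
    linear_combination ω q.2 * this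
  have fin : ∑ q ∈ antidiagonal N, P (σ + q.2) * ω q.2 * (isingBeta (q.1 + 2) - isingBeta (q.1 + 1))
        - ∑ q ∈ antidiagonal N, P (σ + (q.2 + 1 : ℕ)) * ω (q.2 + 1) * (isingBeta (q.1 + 1) - isingBeta q.1) =
      -(P (σ + (N + 1 : ℕ)) * ω (N + 1) * (isingBeta 1 - isingBeta 0)) := by
    rw [hP0, zero_mul, zero_mul, zero_add] at T2
    linear_combination T2 - T1
  have hωN := hω (N + 1)
  have hb1 : isingBeta 1 = 1 / 8 := by
    rw [show (1 : ℕ) = 0 + 1 from rfl, isingBeta_succ 0, isingBeta_zero]; norm_num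
  rw [e2, e1, e0]
  have split : (σ + N + 2) * (σ + N + 3 / 2) * (isingBeta 0 * ω (N + 2) + isingBeta 1 * ω (N + 1) +
        ∑ q ∈ antidiagonal N, isingBeta (q.1 + 2) * ω q.2)
      - (σ + N + 1) * (2 * σ + 2 * N + 7 / 4) * (isingBeta 0 * ω (N + 1) +
        ∑ q ∈ antidiagonal N, isingBeta (q.1 + 1) * ω q.2)
      + (σ + N + 3 / 8) * (σ + N - 1 / 8) * ∑ q ∈ antidiagonal N, isingBeta q.1 * ω q.2 =
      ((σ + N + 2) * (σ + N + 3 / 2) * ∑ q ∈ antidiagonal N, isingBeta (q.1 + 2) * ω q.2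
        - (σ + N + 1) * (2 * σ + 2 * N + 7 / 4) * ∑ q ∈ antidiagonal N, isingBeta (q.1 + 1) * ω q.2
        + (σ + N + 3 / 8) * (σ + N - 1 / 8) * ∑ q ∈ antidiagonal N, isingBeta q.1 * ω q.2)
      + ((σ + N + 2) * (σ + N + 3 / 2) * (isingBeta 0 * ω (N + 2) + isingBeta 1 * ω (N + 1))
        - (σ + N + 1) * (2 * σ + 2 * N + 7 / 4) * (isingBeta 0 * ω (N + 1))) := by ring
  rw [split, main, fin]
  simp only [hP, isingBeta_zero, hb1]
  push_cast at hωN ⊢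
  linear_combination hωN

/-- The next-to-lowest coefficient of `β ∗ ω`: `(σ+1)(σ+1/2) e_1 - σ(2σ-1/4) e_0 = 0`. [folklore] -/
theorem conv_res_one {σ : ℝ} {ω : ℕ → ℝ} (hind : σ * (σ - 1 / 2) = 0)
    (hω : ∀ n : ℕ, ((n : ℝ) + 1 + σ) * ((n : ℝ) + σ + 1 / 2) * ω (n + 1) =
      ((n : ℝ) + σ - 1 / 4) * ((n : ℝ) + σ + 1 / 4) * ω n) :
    (σ + 1) * (σ + 1 / 2) * conv isingBeta ω 1 - σ * (2 * σ - 1 / 4) * conv isingBeta ω 0 = 0 := by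
  have h0 := hω 0
  have hb1 : isingBeta 1 = 1 / 8 := by
    rw [show (1 : ℕ) = 0 + 1 from rfl, isingBeta_succ 0, isingBeta_zero]; norm_num
  unfold conv
  rw [Nat.sum_antidiagonal_succ]
  simp only [Nat.antidiagonal_zero, sum_singleton, isingBeta_zero, hb1]
  push_cast at h0 ⊢
  linear_combination (1 : ℝ) * h0 - (7 / 8 : ℝ) * ω 0 * hind

/-- **A sequence is determined by the recurrence and its first term** (`σ ≥ 0`: the leading
coefficients `(σ+N+2)(σ+N+3/2)` and `(σ+1)(σ+1/2)` never vanish). [folklore] -/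
theorem eq_of_res {σ : ℝ} (hσ : 0 ≤ σ) {v w : ℕ → ℝ} (h0 : v 0 = w 0)
    (h1v : (σ + 1) * (σ + 1 / 2) * v 1 - σ * (2 * σ - 1 / 4) * v 0 = 0)
    (h1w : (σ + 1) * (σ + 1 / 2) * w 1 - σ * (2 * σ - 1 / 4) * w 0 = 0)
    (hv : ∀ N : ℕ, (σ + N + 2) * (σ + N + 3 / 2) * v (N + 2) - (σ + N + 1) * (2 * σ + 2 * N + 7 / 4) * v (N + 1)
      + (σ + N + 3 / 8) * (σ + N - 1 / 8) * v N = 0)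
    (hw : ∀ N : ℕ, (σ + N + 2) * (σ + N + 3 / 2) * w (N + 2) - (σ + N + 1) * (2 * σ + 2 * N + 7 / 4) * w (N + 1)
      + (σ + N + 3 / 8) * (σ + N - 1 / 8) * w N = 0) :
    ∀ N, v N = w N := by
  have pair : ∀ N, v N = w N ∧ v (N + 1) = w (N + 1) := by
    intro N
    induction N with
    | zero =>
      refine ⟨h0, ?_⟩
      have hc : (σ + 1) * (σ + 1 / 2) ≠ 0 := by positivity
      apply mul_left_cancel₀ hc
      linear_combination h1v - h1w + σ * (2 * σ - 1 / 4) * h0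
    | succ N ih =>
      refine ⟨ih.2, ?_⟩
      have hc : (σ + N + 2) * (σ + N + 3 / 2) ≠ 0 := by positivity
      apply mul_left_cancel₀ hc
      rw [show N + 1 + 1 = N + 2 from rfl]
      linear_combination hv N - hw N + (σ + N + 1) * (2 * σ + 2 * N + 7 / 4) * ih.2
        - (σ + N + 3 / 8) * (σ + N - 1 / 8) * ih.1
  exact fun N => (pair N).1

/-! ### Identification of the block coefficients with the Taylor coefficients -/

/-- **The `x`-coefficients of `Σ_j A_j k_{4j}(x)` are those of `f₁ = (1-x)^{-1/8} w₁`**: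
`famCoeff 0 isingA N = Σ_{k+n=N} β_k ω₁(n)`. [cite: BelavinPolyakovZamolodchikov1984, App. E] -/
theorem famCoeff_isingA (N : ℕ) : famCoeff 0 isingA N = conv isingBeta isingOmega₁ N := by
  have hind : (0 : ℝ) * (0 - 1 / 2) = 0 := by norm_num
  have hω : ∀ n : ℕ, ((n : ℝ) + 1 + 0) * ((n : ℝ) + 0 + 1 / 2) * isingOmega₁ (n + 1) =
      ((n : ℝ) + 0 - 1 / 4) * ((n : ℝ) + 0 + 1 / 4) * isingOmega₁ n := isingOmega₁_rec
  refine eq_of_res le_rfl ?_ (famCoeff_res_one isingIdFamily) (conv_res_one hind hω)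
    (famCoeff_res isingIdFamily) (conv_res hind hω) N
  rw [famCoeff_zero, isingA_zero]
  simp [conv, isingOmega_zero.1]

/-- **The `x`-coefficients of `x^{-1/2} Σ_j B_j k_{4j+1}(x)` are those of `x^{-1/2} f₂ = (1-x)^{-1/8} (w₂/√x)`**:
`famCoeff (1/2) isingB N = Σ_{k+n=N} β_k ω₂(n)`. [cite: BelavinPolyakovZamolodchikov1984, App. E] -/
theorem famCoeff_isingB (N : ℕ) : famCoeff (1 / 2) isingB N = conv isingBeta isingOmega₂ N := by
  have hind : (1 / 2 : ℝ) * (1 / 2 - 1 / 2) = 0 := by norm_num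
  have hω : ∀ n : ℕ, ((n : ℝ) + 1 + 1 / 2) * ((n : ℝ) + 1 / 2 + 1 / 2) * isingOmega₂ (n + 1) =
      ((n : ℝ) + 1 / 2 - 1 / 4) * ((n : ℝ) + 1 / 2 + 1 / 4) * isingOmega₂ n := isingOmega₂_rec
  refine eq_of_res (by norm_num) ?_ (famCoeff_res_one isingEpsFamily) (conv_res_one hind hω)
    (famCoeff_res isingEpsFamily) (conv_res hind hω) N
  rw [famCoeff_zero, isingB_zero]
  simp [conv, isingOmega_zero.2]

end Summit.CriticalPhenomena.Ising3D.Control2D
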